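import Summits.NavierStokesRegularity.NavierStokesRegularity.Theses.AdaptedFrequency
import Literature.Analysis.FluidPDE.NSCriticalClosureBesovKatoClass

/-!
# Route AdaptedFrequency — support item `SingularPointExists` (stmt-NavierStokesRegularity-10495)

A MAXIMAL (non-extendable past `T`) classical solution of unforced Navier–Stokes on `ℝ³ × [0, T)`,
Leray–Hopf from its rapidly decaying datum, has a backward-singular point `(T, x₀)`: `u` is
essentially unbounded on every backward parabolic cylinder `Q_r(T, x₀) = (T − r², T) × B_r(x₀)`,
`r > 0`.

Proof: glue of two tree theorems —
* `Literature.Analysis.FluidPDE.exists_singularPoint_of_classical_of_not_hasSmoothExtensionPast`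
  (Lemarié-Rieusset 2016, Thm. 15.1 (C): a finite maximal time of the Kato `C_t L³` solution carries
  a point `x₀` with `u ∉ L^∞(Q_r(T, x₀))`, stated for `0 < r`, `r² < T`), and
* `Literature.Analysis.FluidPDE.eLpNorm_top_parabolicCylinder_eq_top_of_small` (small radii
  suffice, by monotonicity of the cylinders in `r`).
-/

-- the summit and its single sub-problem share the name (CONVENTIONS §1), as in every Theorems file
set_option linter.dupNamespace false

namespace Summit.NavierStokesRegularity.NavierStokesRegularity.Theorems

open MeasureTheory Function Literature.Analysis.FluidPDE
open scoped ENNReal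

/-- **Route AdaptedFrequency, item `SingularPointExists` (stmt-NavierStokesRegularity-10495).**
For `ν > 0`, `T > 0` and a maximal classical solution `(u, p)` of unforced Navier–Stokes on
`ℝ³ × [0, T)` (`IsMaximalSmoothSolution`: classical on `[0, T)`, no classical continuation past
`T`) which is Leray–Hopf from its rapidly decaying datum `u 0`, there is `x₀ ∈ ℝ³` such that
`‖u‖_{L^∞(Q_r(T, x₀))} = ∞` for every `r > 0` (a backward-singular point `(T, x₀)`). From the tree's
`exists_singularPoint_of_classical_of_not_hasSmoothExtensionPast` (Lemarié-Rieusset 2016,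
Thm. 15.1 (C)) and `eLpNorm_top_parabolicCylinder_eq_top_of_small`.
[cite: LemarieRieusset2016, Thm. 15.1 (C)] -/
theorem singularPointExists_proof :
    Summit.NavierStokesRegularity.NavierStokesRegularity.Theses.AdaptedFrequency.SingularPointExists := by
  unfold Summit.NavierStokesRegularity.NavierStokesRegularity.Theses.AdaptedFrequency.SingularPointExists
  intro ν T hν hT u p hmax hLH hdec
  obtain ⟨x₀, hx₀⟩ :=
    exists_singularPoint_of_classical_of_not_hasSmoothExtensionPast hν hT hmax.1 hLH hdec hmax.2
  exact ⟨x₀, fun r hr => eLpNorm_top_parabolicCylinder_eq_top_of_small hT hx₀ hr⟩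

end Summit.NavierStokesRegularity.NavierStokesRegularity.Theorems
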